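import Mathlib
import Summits.Ventures.PercRepro2.Defs
import Summits.Ventures.PercRepro2.Graph
import Summits.Ventures.PercRepro2.OneColourSwitch
import Summits.Ventures.PercRepro2.RegionHubSign
import Summits.Ventures.PercRepro2.SideSwitch
import Summits.Ventures.PercRepro2.SideSwitchFibre
import Summits.Ventures.PercRepro2.SideSwitchComps
import Summits.Ventures.PercRepro2.M9NoPocketDefs
import Summits.Ventures.PercRepro2.M9NoPocketWorld
import Summits.Ventures.PercRepro2.M9NoPocketWorldD
import Summits.Ventures.PercRepro2.M9NoPocketCompl
import Summits.Ventures.PercRepro2.M9NoPocketCompl2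
import Summits.Ventures.PercRepro2.M9NoPocketFlipRS
import Summits.Ventures.PercRepro2.M9PsiOneDefs
import Summits.Ventures.PercRepro2.M9NoPocketFreeBlock
import Summits.Ventures.PercRepro2.M9NoPocketFreeBlockK
import Summits.Ventures.PercRepro2.M9NoPocketSameType
import Summits.Ventures.PercRepro2.M9NoPocketDeadPattern

import Summits.Ventures.PercRepro2.M9NoPocketLinkCompl

/-!
# The links of the unit coordinates (blind cell PercRepro2, p3 g36, 2026-08-29;
`proofs/P3-NPHDR.md` §5(a), (c))

The internal link of a block is blind to dead patterns and to the outside flip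
(`linksIn_flipF_iff`, `linksIn_flipOp_iff`).  Switching non-linking free blocks never changes
`r ~_Y s` (`conn_rs_assignX_union_iff`, by induction from the one-block lemmas of
`M9NoPocketFreeBlock` and `M9NoPocketFreeBlockK`); hence **the `Y`-link of a type-`E` point**
is «a linking free block is unswitched, or the link with every free block switched»
(`conn_rs_E_iff`), and the same for **a `K`-point of a dead pattern** (`conn_rs_K_iff`).  When
every unswitched block is free and `d` has no `Y`-source, `r ~_Y s` holds exactly when an
unswitched block links internally (`conn_rs_iff_exists_linksIn`).  Own work; std axioms.
-/

namespace Summit.Ventures.PercRepro2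

namespace NoPocket

open Finset Classical RegionHub OneColourSwitch SideSwitch

variable {V : Type*} {E : Type*}

section Links

variable [Fintype V] [DecidableEq V] [Fintype E] [DecidableEq E] {ends : E → Sym2 V}

omit [Fintype V] [DecidableEq V] [Fintype E] [DecidableEq E] in
/-- `restrictTo` only sees the edges inside the set. -/
lemma restrictTo_congr {ω ω' : Config E} {S : Set V} (h : ∀ e ∈ within ends S, ω e = ω' e) :
    restrictTo ends ω S = restrictTo ends ω' S := by
  funext e
  unfold restrictTo
  by_cases he : e ∈ within ends S
  · rw [if_pos he, if_pos he, h e he]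
  · rw [if_neg he, if_neg he]

omit [Fintype E] [DecidableEq E] in
/-- `d` is not a block vertex. -/
lemma d_notMem_block {d r s : V} (hr : d ≠ r) (hs : d ≠ s) {ρ : Config E} {C : Finset V}
    (hC : C ∈ blocks ends d r s ρ) : d ∉ C := by
  intro hd
  have hA := subset_A0_of_mem_comps (ends := endsD ends d) hC hd
  rcases (mem_A0.1 hA).1 with h | h
  · exact not_mem_K2_endsD hr hs ρ h
  · exact not_mem_M2_endsD hr hs ρ h

omit [Fintype E] [DecidableEq E] in
/-- An edge inside `C ∪ {r, s}` of a block is not at `d`. -/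
lemma d_notMem_ends_of_within_block {d r s : V} (hr : d ≠ r) (hs : d ≠ s) {ρ : Config E}
    {C : Finset V} (hC : C ∈ blocks ends d r s ρ) {e : E}
    (he : e ∈ within ends (↑C ∪ {r, s} : Set V)) : d ∉ ends e := by
  obtain ⟨x, hx, y, hy, hends⟩ := he
  have hnot : ∀ z ∈ (↑C ∪ {r, s} : Set V), z ≠ d := by
    rintro z (hz | hz)
    · exact fun h => d_notMem_block hr hs hC (h ▸ Finset.mem_coe.1 hz)
    · simp only [Set.mem_insert_iff, Set.mem_singleton_iff] at hz
      rcases hz with rfl | rfl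
      · exact hr.symm
      · exact hs.symm
  rw [hends, Sym2.mem_iff]
  rintro (h | h)
  · exact hnot x hx h.symm
  · exact hnot y hy h.symm

omit [Fintype E] in
/-- The internal link of a block is blind to a dead pattern. -/
lemma linksIn_flipF_iff {d r s : V} (hr : d ≠ r) (hs : d ≠ s) {ρ : Config E} {D : Finset E}
    (hD : ∀ e ∈ D, d ∈ ends e) {C : Finset V} (hC : C ∈ blocks ends d r s ρ) :
    LinksIn ends (flipF D ρ) r s C ↔ LinksIn ends ρ r s C := by
  unfold LinksIn
  rw [restrictTo_congr (ω' := ρ) (fun e he => ?_)]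
  have hnd := d_notMem_ends_of_within_block hr hs hC he
  exact (flipF_eqOn_off_d (ends := ends) (ρ := ρ) hD e hnd).symm

omit [Fintype E] [DecidableEq E] in
/-- The internal link of a block is blind to the outside flip. -/
lemma linksIn_flipOp_iff {d r s : V} {ρ : Config E} {C : Finset V}
    (hC : C ∈ blocks ends d r s ρ) :
    LinksIn ends (flipOp ends d r s ρ) r s C ↔ LinksIn ends ρ r s C := by
  unfold LinksIn
  rw [restrictTo_congr (ω' := ρ) (fun e he => ?_)]
  obtain ⟨x, hx, y, hy, hends⟩ := he
  refine flipOp_of_notMem (not_mem_within_Oprime_of_mem_world hends ?_)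
  rcases hx with hx | hx
  · exact (mem_A0.1 (subset_A0_of_mem_comps (ends := endsD ends d) hC (Finset.mem_coe.1 hx))).1
  · simp only [Set.mem_insert_iff, Set.mem_singleton_iff] at hx
    rcases hx with rfl | rfl
    · exact Or.inl (r_mem_K2 _ _ _)
    · exact Or.inl (s_mem_K2 _ _ _)

omit [Fintype V] [Fintype E] in
/-- **Switching non-linking free blocks does not change `r ~_Y s`** — by induction from a
one-block step valid on a class `Q` of block sets stable under adding the blocks of `F'`. -/
theorem conn_rs_assignX_union_iff {r s : V} (ρ : Config E)
    (Q : Finset (Finset V) → Prop) {X F' : Finset (Finset V)} (hQ : Q X)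
    (hQins : ∀ Y, Q Y → ∀ C ∈ F', Q (insert C Y))
    (hstep : ∀ Y, Q Y → ∀ C ∈ F', C ∉ Y →
      (Conn ends (assignX ends (insert C Y, ∅) ρ) r s ↔ Conn ends (assignX ends (Y, ∅) ρ) r s)) :
    Conn ends (assignX ends (X ∪ F', ∅) ρ) r s ↔ Conn ends (assignX ends (X, ∅) ρ) r s := by
  induction F' using Finset.induction_on with
  | empty => simp
  | insert C F'' hCF ih =>
    have hQins' : ∀ Y, Q Y → ∀ C' ∈ F'', Q (insert C' Y) :=
      fun Y hY C' hC' => hQins Y hY C' (Finset.mem_insert_of_mem hC')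
    have hstep' : ∀ Y, Q Y → ∀ C' ∈ F'', C' ∉ Y →
        (Conn ends (assignX ends (insert C' Y, ∅) ρ) r s ↔
          Conn ends (assignX ends (Y, ∅) ρ) r s) :=
      fun Y hY C' hC' hC'Y => hstep Y hY C' (Finset.mem_insert_of_mem hC') hC'Y
    have ih' := ih hQins' hstep'
    rw [Finset.union_insert]
    by_cases hmem : C ∈ X ∪ F''
    · rw [Finset.insert_eq_of_mem hmem]
      exact ih'
    · have hQX : Q (X ∪ F'') := by
        -- `X ∪ F''` is obtained from `X` by inserting the blocks of `F''`
        have key : ∀ G : Finset (Finset V), G ⊆ F'' → Q (X ∪ G) := by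
          intro G
          induction G using Finset.induction_on with
          | empty => intro _; simpa using hQ
          | insert C' G' hC'G' ihG =>
            intro hsub
            rw [Finset.union_insert]
            exact hQins' _ (ihG ((Finset.subset_insert _ _).trans hsub)) C'
              (hsub (Finset.mem_insert_self _ _))
        exact key F'' (Finset.Subset.refl _)
      rw [hstep (X ∪ F'') hQX C (Finset.mem_insert_self _ _) hmem]
      exact ih'

/-- **The `Y`-link of a type-`E` point** of a same-type representative: a linking free block
is unswitched, or the link survives with every free block switched. -/
theorem conn_rs_E_iff {p q r s d : V} (hnp : NoPocketAt ends d r s) (hr : d ≠ r) (hs : d ≠ s)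
    {ρ₀ : Config E} (hρ₀ : ρ₀ ∈ RepD ends p q r s d)
    (hst : ∀ e, d ∈ ends e → ρ₀ e = true) {X : Finset (Finset V)}
    (hX : X ⊆ blocks ends d r s ρ₀) :
    Conn ends (assignX ends (X, ∅) ρ₀) r s ↔
      (¬ ((blocks ends d r s ρ₀).filter (fun C => ¬ hasY ends d ρ₀ C)).filter
          (LinksIn ends ρ₀ r s) ⊆ X) ∨
        Conn ends (assignX ends
          (X ∪ (blocks ends d r s ρ₀).filter (fun C => ¬ hasY ends d ρ₀ C), ∅) ρ₀) r s := by
  by_cases hL : ((blocks ends d r s ρ₀).filter (fun C => ¬ hasY ends d ρ₀ C)).filter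
      (LinksIn ends ρ₀ r s) ⊆ X
  · -- every linking free block is switched: switch the other free blocks one by one
    have hfilt : X ∪ (blocks ends d r s ρ₀).filter (fun C => ¬ hasY ends d ρ₀ C) =
        X ∪ ((blocks ends d r s ρ₀).filter (fun C => ¬ hasY ends d ρ₀ C) \ X) :=
      (Finset.union_sdiff_self_eq_union).symm
    rw [hfilt]
    have hsame : ∀ C' ∈ blocks ends d r s ρ₀, ¬ hasW ends d ρ₀ C' :=
      fun C' _ => not_hasW_of_sameType hst C'
    have hiff := conn_rs_assignX_union_iff (ends := ends) (r := r) (s := s) ρ₀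
      (fun Y => Y ⊆ blocks ends d r s ρ₀) (X := X)
      (F' := (blocks ends d r s ρ₀).filter (fun C => ¬ hasY ends d ρ₀ C) \ X)
      hX (fun Y hY C hC => Finset.insert_subset
        (Finset.mem_filter.1 (Finset.mem_sdiff.1 hC).1).1 hY)
      (fun Y hY C hC hCY => by
        obtain ⟨hCf, hCX⟩ := Finset.mem_sdiff.1 hC
        obtain ⟨hCb, hCY'⟩ := Finset.mem_filter.1 hCf
        have hfree : Free ends d C := (free_iff_not_hasY_sameType hst C).2 hCY'
        have hnl : ¬ LinksIn ends ρ₀ r s C := fun hl =>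
          hCX (hL (Finset.mem_filter.2 ⟨hCf, hl⟩))
        exact conn_rs_insert_free_iff hnp hρ₀ hr hs hsame (x := (Y, ∅)) hY rfl hCb hCY hfree hnl)
    rw [hiff]
    exact ⟨fun h => Or.inr h, fun h => h.resolve_left (fun h' => h' hL)⟩
  · refine ⟨fun _ => Or.inl hL, fun _ => ?_⟩
    obtain ⟨C, hC, hCX⟩ := Finset.not_subset.1 hL
    obtain ⟨hCf, hl⟩ := Finset.mem_filter.1 hC
    exact conn_rs_of_linksIn hρ₀ hr hs hX rfl (Finset.mem_filter.1 hCf).1 hCX hl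

/-- **The `Y`-link of a `K`-point of a dead pattern**: a linking free block is unswitched, or
the link survives with every free block switched. -/
theorem conn_rs_K_iff {p q r s d : V} (hnp : NoPocketAt ends d r s) (hr : d ≠ r) (hs : d ≠ s)
    (hT : Tset ends d r s = ∅) {ρ₀ : Config E} (hρ₀ : ρ₀ ∈ RepD ends p q r s d)
    (hst : ∀ e, d ∈ ends e → ρ₀ e = true) {D : Finset E} (hD : ∀ e ∈ D, d ∈ ends e)
    {T : Finset (Finset V)}
    (hTf : T ⊆ (blocks ends d r s ρ₀).filter (fun C => ¬ hasY ends d ρ₀ C)) :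
    Conn ends (assignX ends (T, ∅) (flipF D ρ₀)) r s ↔
      (¬ ((blocks ends d r s ρ₀).filter (fun C => ¬ hasY ends d ρ₀ C)).filter
          (LinksIn ends ρ₀ r s) ⊆ T) ∨
        Conn ends (assignX ends
          ((blocks ends d r s ρ₀).filter (fun C => ¬ hasY ends d ρ₀ C), ∅) (flipF D ρ₀)) r s := by
  have hρD := flipF_mem_RepD hρ₀ hT hD
  have hb := blocks_flipF (ends := ends) (r := r) (s := s) (ρ := ρ₀) hD
  have hTb : T ⊆ blocks ends d r s ρ₀ := hTf.trans (Finset.filter_subset _ _)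
  by_cases hL : ((blocks ends d r s ρ₀).filter (fun C => ¬ hasY ends d ρ₀ C)).filter
      (LinksIn ends ρ₀ r s) ⊆ T
  · have hfilt : (blocks ends d r s ρ₀).filter (fun C => ¬ hasY ends d ρ₀ C) =
        T ∪ ((blocks ends d r s ρ₀).filter (fun C => ¬ hasY ends d ρ₀ C) \ T) :=
      (Finset.union_sdiff_of_subset hTf).symm
    have hiff := conn_rs_assignX_union_iff (ends := ends) (r := r) (s := s) (flipF D ρ₀)
      (fun Y => Y ⊆ (blocks ends d r s ρ₀).filter (fun C => ¬ hasY ends d ρ₀ C)) (X := T)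
      (F' := (blocks ends d r s ρ₀).filter (fun C => ¬ hasY ends d ρ₀ C) \ T)
      hTf (fun Y hY C hC => Finset.insert_subset (Finset.mem_sdiff.1 hC).1 hY)
      (fun Y hY C hC hCY => by
        obtain ⟨hCf, hCT⟩ := Finset.mem_sdiff.1 hC
        obtain ⟨hCb, hCY'⟩ := Finset.mem_filter.1 hCf
        have hfree : Free ends d C := (free_iff_not_hasY_sameType hst C).2 hCY'
        have hnl : ¬ LinksIn ends ρ₀ r s C := fun hl =>
          hCT (hL (Finset.mem_filter.2 ⟨hCf, hl⟩))
        have hYfree : ∀ C' ∈ Y, Free ends d C' := fun C' hC' =>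
          (free_iff_not_hasY_sameType hst C').2 (Finset.mem_filter.1 (hY hC')).2
        have hYb : Y ⊆ blocks ends d r s ρ₀ := hY.trans (Finset.filter_subset _ _)
        exact conn_rs_insert_free_iff_flipF hnp hρ₀ hT hr hs hD (x := (Y, ∅)) hYb rfl hYfree
          hCb hCY hfree ((linksIn_flipF_iff hr hs hD hCb).not.2 hnl))
    have hiff' : Conn ends (assignX ends
        ((blocks ends d r s ρ₀).filter (fun C => ¬ hasY ends d ρ₀ C), ∅) (flipF D ρ₀)) r s ↔
        Conn ends (assignX ends (T, ∅) (flipF D ρ₀)) r s := by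
      rw [hfilt]
      exact hiff
    rw [hiff']
    exact ⟨fun h => Or.inr h, fun h => h.resolve_left (fun h' => h' hL)⟩
  · refine ⟨fun _ => Or.inl hL, fun _ => ?_⟩
    obtain ⟨C, hC, hCT⟩ := Finset.not_subset.1 hL
    obtain ⟨hCf, hl⟩ := Finset.mem_filter.1 hC
    have hCb : C ∈ blocks ends d r s (flipF D ρ₀) := by
      rw [hb]; exact (Finset.mem_filter.1 hCf).1
    have hTb' : T ⊆ blocks ends d r s (flipF D ρ₀) := by rw [hb]; exact hTb
    exact conn_rs_of_linksIn hρD hr hs hTb' rfl hCb hCT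
      ((linksIn_flipF_iff hr hs hD (Finset.mem_filter.1 hCf).1).2 hl)

/-- **The free-only link.**  When every unswitched block is free and `d` has no `Y`-source,
`r ~_Y s` holds in the assignment exactly when an unswitched block links internally. -/
theorem conn_rs_iff_exists_linksIn {p q r s d : V} (hnp : NoPocketAt ends d r s) (hr : d ≠ r)
    (hs : d ≠ s) (hrs : ∀ e, ends e ≠ s(r, s)) (hrs' : r ≠ s) {ρ : Config E}
    (hρ : ρ ∈ RepD ends p q r s d) {X : Finset (Finset V)} (hX : X ⊆ blocks ends d r s ρ)
    (hfree : ∀ C ∈ blocks ends d r s ρ, C ∉ X → Free ends d C)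
    (hsrc : ¬ srcY ends d r s ρ (X, ∅)) :
    Conn ends (assignX ends (X, ∅) ρ) r s ↔
      ∃ C ∈ blocks ends d r s ρ, C ∉ X ∧ LinksIn ends ρ r s C := by
  constructor
  · intro h
    set ω := assignX ends (X, ∅) ρ with hω
    have hF : ((X, ∅) : Finset (Finset V) × Finset E).2 ⊆ Tset ends d r s :=
      Finset.empty_subset _
    -- the `Y`-world of the assignment: `r`, `s` and the unswitched (free) blocks
    have hK : ∀ v ∈ K2 ends r s ω, v = r ∨ v = s ∨
        ∃ C ∈ blocks ends d r s ρ, C ∉ X ∧ v ∈ C := by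
      intro v hv
      rw [K2_assignX hnp hρ hX hF hr hs (fun h' => absurd h' hsrc)] at hv
      rcases hv with hv | ⟨_, hv⟩
      · rw [K2_endsD_assignX hρ hX hF] at hv
        obtain ⟨hvK, hvX⟩ := hv
        rcases mem_A0_of_mem_K2_endsD hvK with h' | h' | h'
        · exact Or.inl h'
        · exact Or.inr (Or.inl h')
        · obtain ⟨hC, hvC⟩ := block_of_mem_A0 (ends := ends) (r := r) (s := s) (ρ := ρ) h'
          exact Or.inr (Or.inr ⟨_, hC, block_notMem_of_notMem_unionT hρ hX hC hvC
            (fun h'' => hvX (Finset.mem_coe.2 h'')), hvC⟩)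
      · exact absurd hv hsrc
    -- the closure set
    have key : s ∈ {z | (∃ C ∈ blocks ends d r s ρ, C ∉ X ∧ LinksIn ends ρ r s C) ∨ z = r ∨
        ∃ C ∈ blocks ends d r s ρ, C ∉ X ∧ z ∈ C ∧
          Conn ends (restrictTo ends ω (↑C ∪ {r, s})) r z} := by
      refine mem_of_conn_of_closed (ends := ends) (ω := ω) ?_ (Or.inr (Or.inl rfl)) h
      rintro z (hz | hzr | ⟨C, hC, hCX, hzC, hz⟩) v hadj
      · exact Or.inl hz
      · obtain rfl := hzr.symm
        obtain ⟨_, e, he, hends⟩ := openGraph_adj.1 hadj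
        have hvK : v ∈ K2 ends r s ω := mem_K2_of_open (r_mem_K2 _ _ _) he hends
        rcases hK v hvK with hvr | hvs | ⟨C, hC, hCX, hvC⟩
        · rw [hvr]
          exact Or.inr (Or.inl rfl)
        · rw [hvs] at hends
          exact absurd hends (hrs e)
        · refine Or.inr (Or.inr ⟨C, hC, hCX, hvC, conn_of_openAdj ⟨e, ?_, hends⟩⟩)
          unfold restrictTo
          rw [if_pos ⟨r, Or.inr (Or.inl rfl), v, Or.inl (Finset.mem_coe.2 hvC), hends⟩]
          exact he
      · obtain ⟨_, e, he, hends⟩ := openGraph_adj.1 hadj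
        by_cases hvC : v ∈ C
        · refine Or.inr (Or.inr ⟨C, hC, hCX, hvC, conn_trans hz (conn_of_openAdj ⟨e, ?_, hends⟩)⟩)
          unfold restrictTo
          rw [if_pos ⟨z, Or.inl (Finset.mem_coe.2 hzC), v, Or.inl (Finset.mem_coe.2 hvC), hends⟩]
          exact he
        · rcases free_block_exit hρ hr hs hX rfl hC hCX (hfree C hC hCX) hends hzC hvC he
            with hvr | hvs
          · rw [hvr]
            exact Or.inr (Or.inl rfl)
          · -- `r ~ s` inside `C ∪ {r, s}`: the block links
            rw [hvs] at hends
            refine Or.inl ⟨C, hC, hCX, ?_⟩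
            have h1 : Conn ends (restrictTo ends ω (↑C ∪ {r, s})) r s := by
              refine conn_trans hz (conn_of_openAdj ⟨e, ?_, hends⟩)
              unfold restrictTo
              rw [if_pos ⟨z, Or.inl (Finset.mem_coe.2 hzC), s, Or.inr (Or.inr rfl), hends⟩]
              exact he
            have heq : restrictTo ends ω (↑C ∪ {r, s}) = restrictTo ends ρ (↑C ∪ {r, s}) :=
              restrictTo_congr (fun e' he' => assignX_eq_of_within hρ hr hs hX rfl hC hCX he')
            rw [heq] at h1
            exact h1
    rcases key with hk | hk | ⟨C, hC, _, hsC, _⟩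
    · exact hk
    · exact absurd hk.symm hrs'
    · exact absurd hsC (r_notMem_block hρ hC).2
  · rintro ⟨C, hC, hCX, hl⟩
    exact conn_rs_of_linksIn hρ hr hs hX rfl hC hCX hl

end Links

end NoPocket

end Summit.Ventures.PercRepro2
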